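import Summits.CriticalPhenomena.PercolationContinuityZ3.Theorems.PercAnnulusCrossingSlabMSFSurgery
import Literature.Probability.Percolation.SlabMSFEvents
import Literature.Probability.Percolation.PercolationProofs
import HarnessLib

/-!
# RSW3 lane (lead, gen 45): NTW 2017 §4 — THE PIECES OF THE GLUING LEMMA FOR INVASION: measurability of `𝓑_x^{m}`, of the
# landing data and of the Step-2 test; the surgery in the event vocabulary (file F7, first part, of the build-out of Thm 2.4)

builds on p205010 (kernel theorem, internal audit signed; external expert review pending) — NOT used in this file.

Cell `prim-rsw3`, lead seat (gen 45), blueprint `prim-rsw3-lead/gen44/BUILDOUT-PLAN.md` §4 (measurability half of Lemma 4.1).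
Support file (`--supports stmt-CriticalPhenomena-4575`); no definitions, no named facts, no sorries.  Vocabulary of
`SlabMSFEvents.lean`: `evCircuit` (= `C_{n,2n}`), `circuitOf` (= `Γ_min`), `evBlocked` (= `D′`), `stoppedInv` (= `𝓘_a^{m}`),
`evGlued a` (= `𝓑_a^{m}`), `landZ`/`landW` (= `z(ω)`, `w`), `evStepTwo` (the Step-2 test), `pieceS`/`pieceLZ`/`pieceLZW` (the data
`Ŝ`, `L̂` of Lemma 4.2), `goodLabels` (= `[0,1]^E`).

Newman–Tassion–Wu (arXiv:1512.09107, p. 19 and Lemma 4.2): the gluing lemma compares probabilities of the events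
`(𝓑_0)^c ∩ 𝓑_x ∩ 𝒴_A`, … through "a measurable map `Φ : 𝓐 → 𝓑`"; the tree's Lemma 4.2
(`NTW17.labelMeasure_real_le_of_affineRelabel_self`) asks for the measurability of the pieces `𝓐 ∩ {Ŝ = S, L̂ = L}`.  Here:

* **`measurableSet_evGlued`** — `𝓑_a^{m}` is measurable (fibres of `Γ_min` are pull-backs of local events,
  `measurableSet_circuitOf_eq`; the stopped invasion is measurable, `Rsw3.measurable_stoppedInvasion_prop`);
* **`measurableSet_fibre`** — the fibres `{Γ_min = Γ₀, z = z₀, w = w₀}` of the landing data are measurable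
  (`Rsw3.measurable_exitVertex_eq`), and **`measurableSet_of_fibres`** — a set all of whose fibre-sections are measurable is
  measurable (countably many fibres);
* `measurable_cfgZ_comp` — `U ↦ cfgZ (η_p U) Γ₀ z₀` is measurable; **`measurableSet_evStepTwo`** — the Step-2 test is a
  measurable event; **`measurableSet_piece`** — the pieces `{Ŝ = S, L̂ = L}` (both variants) are measurable;
* the surgery read in the event vocabulary: **`surgery_mapsTo_ZW`**, **`surgery_mapsTo_Z`**, **`surgery_mapsTo_Z3`** — on
  `[0,1]^E ∩ (𝓑_a)^c ∩ [𝓑_x ∩] C ∩ D′ [∩ test / ∩ ¬test]` the relabelled field `T_{Ŝ(U),L̂(U)} U` lies in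
  `𝓑_a ∩ [𝓑_x ∩] C ∩ D′`, has the same `Γ_min`, the same `Ŝ`, stays in `[0,1]^E`, and agrees with `U` on every pair having an
  endpoint over `B_{n-1}` (so every event `A` determined by those pairs is preserved) — the hypotheses `hmaps`, `hrec`, `hsub` of
  Lemma 4.2 for the three inequalities (g1), (g2) [= (g1) with the roots exchanged], (g3).

References: C. M. Newman, V. Tassion, W. Wu, *Critical percolation and the minimal spanning tree in slabs*, CPAM 70 (2017),
arXiv:1512.09107, §4 p. 19, Lemma 4.2, §4.1 pp. 20–21 [NewmanTassionWu2017].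
-/

noncomputable section

namespace Summit.CriticalPhenomena.PercolationContinuityZ3.Theorems.Crossing

open MeasureTheory
open Literature.Probability.Percolation Literature.Probability.LatticeModels
open Literature.Probability.Percolation.NTW17 Literature.Probability.Percolation.Invasion

variable {k : ℕ} {p : ℝ} {n N M : ℕ} {a x : slab 3 k}

/-! ## Measurability of `𝓑_a`, of the fibres of the landing data, of the Step-2 test -/

/-- **`𝓑_a^{m}` is measurable.** [cite: NewmanTassionWu2017, §4 ("𝓩^{i-1} is measurable with respect to the state of edges in B̄_{m_{i-1}}")] -/
theorem measurableSet_evGlued (a : slab 3 k) : MeasurableSet (evGlued k p n N M a) := by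
  have : evGlued k p n N M a = ⋃ Γ₀ : List (slab 3 k), {U | circuitOf k p n N U = Γ₀} ∩
      {U | ∀ g ∈ Γ₀, g ∈ stoppedInv k M U a} := by
    ext U
    simp only [mem_evGlued_iff, Set.mem_iUnion, Set.mem_inter_iff, Set.mem_setOf_eq]
    exact ⟨fun h => ⟨_, rfl, h⟩, fun ⟨Γ₀, hΓ, h⟩ => hΓ ▸ h⟩
  rw [this]
  refine MeasurableSet.iUnion fun Γ₀ => (measurableSet_circuitOf_eq Γ₀).inter ?_
  exact measurableSet_setOf.2 (Rsw3.measurable_stoppedInvasion_prop (G := slabGraph 3 k) a _ fun I => ∀ g ∈ Γ₀, g ∈ I)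

/-- **The fibres of the landing data are measurable**: `{Γ_min = Γ₀} ∩ {z = z₀} ∩ {w = w₀}` (on the fibre of `Γ_min` the landing
vertices are break-out vertices of FIXED finite sets). [cite: NewmanTassionWu2017, Lemma 4.2 ("a measurable map Φ")] -/
theorem measurableSet_fibre (a x : slab 3 k) (Γ₀ : List (slab 3 k)) (z₀ w₀ : slab 3 k) :
    MeasurableSet {U | circuitOf k p n N U = Γ₀ ∧ landZ k p n N U a = z₀ ∧ landW k p n N M U a x = w₀} := by
  have : {U | circuitOf k p n N U = Γ₀ ∧ landZ k p n N U a = z₀ ∧ landW k p n N M U a x = w₀} =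
      {U | circuitOf k p n N U = Γ₀} ∩
        ({U | exitVertex (slabGraph 3 k) U a (insideFin k Γ₀ N) = z₀} ∩
          {U | exitVertex (slabGraph 3 k) U x (wDom k Γ₀ z₀ M) = w₀}) := by
    ext U
    simp only [Set.mem_setOf_eq, Set.mem_inter_iff, landZ_eq, landW_eq, zHat, wHat]
    constructor
    · rintro ⟨hΓ, hz, hw⟩
      subst hΓ
      exact ⟨rfl, hz, by rw [hz] at hw; exact hw⟩
    · rintro ⟨hΓ, hz, hw⟩
      subst hΓ
      exact ⟨rfl, hz, by rw [hz]; exact hw⟩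
  rw [this]
  exact (measurableSet_circuitOf_eq Γ₀).inter
    ((measurableSet_setOf.2 (Rsw3.measurable_exitVertex_eq (G := slabGraph 3 k) a _ z₀)).inter
      (measurableSet_setOf.2 (Rsw3.measurable_exitVertex_eq (G := slabGraph 3 k) x _ w₀)))

/-- **A set of label fields all of whose sections by the fibres of the landing data are measurable is measurable** (the datum
`(Γ_min, z, w)` takes countably many values). [cite: NewmanTassionWu2017, Lemma 4.2 (proof: "a disjoint partition {A_i} of 𝓐")] -/
theorem measurableSet_of_fibres (a x : slab 3 k) {E : Set (Sym2 (slab 3 k) → ℝ)}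
    (h : ∀ (Γ₀ : List (slab 3 k)) (z₀ w₀ : slab 3 k),
      MeasurableSet (E ∩ {U | circuitOf k p n N U = Γ₀ ∧ landZ k p n N U a = z₀ ∧ landW k p n N M U a x = w₀})) :
    MeasurableSet E := by
  have hE : E = ⋃ Γ₀ : List (slab 3 k), ⋃ z₀ : slab 3 k, ⋃ w₀ : slab 3 k,
      E ∩ {U | circuitOf k p n N U = Γ₀ ∧ landZ k p n N U a = z₀ ∧ landW k p n N M U a x = w₀} := by
    ext U
    simp only [Set.mem_iUnion, Set.mem_inter_iff, Set.mem_setOf_eq]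
    exact ⟨fun hU => ⟨_, _, _, hU, rfl, rfl, rfl⟩, fun ⟨_, _, _, hU, _⟩ => hU⟩
  rw [hE]
  exact MeasurableSet.iUnion fun Γ₀ => MeasurableSet.iUnion fun z₀ => MeasurableSet.iUnion fun w₀ => h Γ₀ z₀ w₀

/-- `U ↦ cfgZ (η_p U) Γ₀ z₀` is a measurable map into configurations (fixed `Γ₀`, `z₀`).
[cite: NewmanTassionWu2017, Lemma 4.2 ("a measurable map Φ")] -/
theorem measurable_cfgZ_comp (Γ₀ : List (slab 3 k)) (z₀ : slab 3 k) :
    Measurable fun U : Sym2 (slab 3 k) → ℝ => cfgZ k (configOfLabels p U (slabGraph 3 k)) Γ₀ z₀ := by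
  refine measurable_set_iff.2 fun e => ?_
  show Measurable fun U : Sym2 (slab 3 k) → ℝ =>
    (e ∈ configOfLabels p U (slabGraph 3 k) ∧ e ∉ surgS k Γ₀ (landCol k Γ₀ z₀)) ∨ e ∈ edgesOf (gammaZ k Γ₀ z₀)
  exact (((measurable_set_iff.1 (measurable_configOfLabels p (slabGraph 3 k)) e).and measurable_const).or
    measurable_const)

/-- On a fibre the Step-2 test is a fixed reachability question in `cfgZ (η_p U) Γ₀ z₀`, hence measurable.
[cite: NewmanTassionWu2017, §4.1 (Step 2's test) and Lemma 4.2 ("a measurable map Φ")] -/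
theorem measurableSet_evStepTwo_inter_fibre (a x : slab 3 k) (Γ₀ : List (slab 3 k)) (z₀ w₀ : slab 3 k) :
    MeasurableSet (evStepTwo k p n N M a x ∩
      {U | circuitOf k p n N U = Γ₀ ∧ landZ k p n N U a = z₀ ∧ landW k p n N M U a x = w₀}) := by
  have hR : ∀ g : slab 3 k, Measurable fun U : Sym2 (slab 3 k) → ℝ =>
      (openGraph (cfgZ k (configOfLabels p U (slabGraph 3 k)) Γ₀ z₀)).Reachable w₀ g := fun g =>
    measurableSet_setOf.1 ((measurableSet_openConn_holds w₀ g).preimage (measurable_cfgZ_comp Γ₀ z₀))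
  have hT : MeasurableSet {U : Sym2 (slab 3 k) → ℝ |
      ∀ g : slab 3 k, ¬ (g ∈ Γ₀ ∧ (openGraph (cfgZ k (configOfLabels p U (slabGraph 3 k)) Γ₀ z₀)).Reachable w₀ g)} :=
    measurableSet_setOf.2 (Measurable.forall fun g => (measurable_const.and (hR g)).not)
  have : evStepTwo k p n N M a x ∩
      {U | circuitOf k p n N U = Γ₀ ∧ landZ k p n N U a = z₀ ∧ landW k p n N M U a x = w₀} =
      {U : Sym2 (slab 3 k) → ℝ |
        ∀ g : slab 3 k, ¬ (g ∈ Γ₀ ∧ (openGraph (cfgZ k (configOfLabels p U (slabGraph 3 k)) Γ₀ z₀)).Reachable w₀ g)} ∩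
      {U | circuitOf k p n N U = Γ₀ ∧ landZ k p n N U a = z₀ ∧ landW k p n N M U a x = w₀} := by
    ext U
    simp only [Set.mem_inter_iff, Set.mem_setOf_eq, mem_evStepTwo_iff]
    constructor
    · rintro ⟨h, hΓ, hz, hw⟩
      refine ⟨fun g ⟨hg, hr⟩ => ?_, hΓ, hz, hw⟩
      rw [hΓ, hz, hw] at h
      exact h g hg hr
    · rintro ⟨h, hΓ, hz, hw⟩
      refine ⟨fun g hg hr => h g ⟨?_, ?_⟩, hΓ, hz, hw⟩
      · rwa [hΓ] at hg
      · rwa [hΓ, hz, hw] at hr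
  rw [this]
  exact hT.inter (measurableSet_fibre a x Γ₀ z₀ w₀)

/-- **The Step-2 test is a measurable event.** [cite: NewmanTassionWu2017, §4.1 (Step 2) and Lemma 4.2 ("a measurable map Φ")] -/
theorem measurableSet_evStepTwo (a x : slab 3 k) : MeasurableSet (evStepTwo k p n N M a x) :=
  measurableSet_of_fibres a x fun Γ₀ z₀ w₀ => measurableSet_evStepTwo_inter_fibre a x Γ₀ z₀ w₀

/-- **The pieces `{Ŝ = S, L̂ = L}` of Steps 1–3 are measurable** (on a fibre both data are constant).
[cite: NewmanTassionWu2017, Lemma 4.2 (the pieces A_i)] -/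
theorem measurableSet_pieceZW (a x : slab 3 k) (S L : Finset (Sym2 (slab 3 k))) :
    MeasurableSet {U | pieceS k p n N a U = S ∧ pieceLZW k p n N M a x U = L} := by
  refine measurableSet_of_fibres (p := p) (n := n) (N := N) (M := M) a x fun Γ₀ z₀ w₀ => ?_
  by_cases hc : surgFin k Γ₀ (landCol k Γ₀ z₀) = S ∧
      edgesFin k (gammaZ k Γ₀ z₀) ∪ edgesFin k (gammaW k Γ₀ z₀ w₀) = L
  · convert measurableSet_fibre (p := p) (n := n) (N := N) (M := M) a x Γ₀ z₀ w₀ using 1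
    ext U
    simp only [Set.mem_inter_iff, Set.mem_setOf_eq, pieceS_eq, pieceLZW_eq, and_iff_right_iff_imp]
    rintro ⟨hΓ, hz, hw⟩
    rw [hΓ, hz, hw]
    exact hc
  · convert MeasurableSet.empty using 1
    ext U
    simp only [Set.mem_inter_iff, Set.mem_setOf_eq, pieceS_eq, pieceLZW_eq, Set.mem_empty_iff_false, iff_false]
    rintro ⟨hSL, hΓ, hz, hw⟩
    rw [hΓ, hz, hw] at hSL
    exact hc hSL

/-- **The pieces `{Ŝ = S, L̂ = L}` of Steps 1 and 3 are measurable.** [cite: NewmanTassionWu2017, Lemma 4.2 (the pieces A_i)] -/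
theorem measurableSet_pieceZ (a x : slab 3 k) (S L : Finset (Sym2 (slab 3 k))) :
    MeasurableSet {U | pieceS k p n N a U = S ∧ pieceLZ k p n N a U = L} := by
  refine measurableSet_of_fibres (p := p) (n := n) (N := N) (M := 0) a x fun Γ₀ z₀ w₀ => ?_
  by_cases hc : surgFin k Γ₀ (landCol k Γ₀ z₀) = S ∧ edgesFin k (gammaZ k Γ₀ z₀) = L
  · convert measurableSet_fibre (p := p) (n := n) (N := N) (M := 0) a x Γ₀ z₀ w₀ using 1
    ext U
    simp only [Set.mem_inter_iff, Set.mem_setOf_eq, pieceS_eq, pieceLZ_eq, and_iff_right_iff_imp]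
    rintro ⟨hΓ, hz, -⟩
    rw [hΓ, hz]
    exact hc
  · convert MeasurableSet.empty using 1
    ext U
    simp only [Set.mem_inter_iff, Set.mem_setOf_eq, pieceS_eq, pieceLZ_eq, Set.mem_empty_iff_false, iff_false]
    rintro ⟨hSL, hΓ, hz, -⟩
    rw [hΓ, hz] at hSL
    exact hc hSL

/-! ## The surgery in the event vocabulary -/

section MapsTo

variable {b : ℝ} {U : Sym2 (slab 3 k) → ℝ}

/-- The modified pairs have both endpoints of planar sup-norm `≥ n` (they lie in the plus cylinder about a column of `Γ_min`,
whose columns have norm `> n`); so the relabelled field agrees with `U` on every pair having an endpoint over `B_{n-1}`.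
[cite: NewmanTassionWu2017, §4.1 ("for any Borel measurable set A ⊂ [0,1]^{B̄_{m_{i-1}}}", the surgery acts inside B̄₁^#(z′))] -/
theorem affineRelabel_pieceS_apply_eq_of_near (hn : 1 ≤ n) (hnN : n ≤ N) (hC : U ∈ evCircuit k p n N)
    (ha : planar k a ∈ sqBox ((0 : ℤ), (0 : ℤ)) (n - 1)) (L : Finset (Sym2 (slab 3 k))) {e : Sym2 (slab 3 k)}
    (he : ∃ v ∈ e, planar k v ∈ sqBox ((0 : ℤ), (0 : ℤ)) (n - 1)) :
    affineRelabel p b (pieceS k p n N a U) L U e = U e := by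
  refine affineRelabel_apply_of_not_mem (fun heS => ?_) U
  rw [pieceS_eq, mem_surgFin_iff] at heS
  obtain ⟨hΓo, hs⟩ := isOpenCircuit_circuitOf hC
  have hω := configOfLabels_subset_edgeSet p U
  have haF := mem_insideFin_of_planar_mem_sqBox hΓo hn hnN ha
  have hzadj := exists_planarAdj_zHat hω hΓo hs (U := U) haF
  obtain ⟨v, hv, hvn⟩ := he
  obtain ⟨g, hgΓ, hgy⟩ := (landCol_spec hzadj).1
  have hy : landCol k (circuitOf k p n N U) (landZ k p n N U a) ∈ annulus ((0 : ℤ), (0 : ℤ)) n N := by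
    rw [landZ_eq, ← hgy]; exact hΓo.subset g hgΓ
  have hq : planar k v ∈ sqBox (landCol k (circuitOf k p n N U) (landZ k p n N U a)) 1 :=
    plusCols_subset_sqBox _ ((surgS_subset_plusEdges _ _ heS).2 v hv)
  have hy' : landCol k (circuitOf k p n N U) (landZ k p n N U a) ∈ sqBox (planar k v) 1 := by
    rw [mem_sqBox_iff'] at hq ⊢; omega
  have : landCol k (circuitOf k p n N U) (landZ k p n N U a) ∈ sqBox ((0 : ℤ), (0 : ℤ)) (n - 1 + 1) := mem_sqBox_add hvn hy'
  rw [Nat.sub_add_cancel hn] at this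
  exact hy.2 this

/-- **The surgery of Steps 1, 2, 3 maps `[0,1]^E ∩ (𝓑_a)^c ∩ 𝓑_x ∩ C ∩ D′ ∩ {test}` into `𝓑_a ∩ 𝓑_x ∩ C ∩ D′`, keeps
`Γ_min` and `Ŝ`, stays in `[0,1]^E`.** [cite: NewmanTassionWu2017, §4.1 (proof of (g1): "By construction, ω′ ∈ 𝓑_0^{m_i} ∩ 𝓑_x^{m_i} ∩ 𝒴_A^i", "Γ_min(ω′) = Γ_min(ω)", "S(ω) = S(ω′)")] -/
theorem surgery_mapsTo_ZW (hp : 0 < p) (hpb : p < b) (hb1 : b < 1) (hn : 1 ≤ n) (hnN : n ≤ N) (hNM : N + 1 ≤ M)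
    (ha : planar k a ∈ sqBox ((0 : ℤ), (0 : ℤ)) (n - 1)) (hx : planar k x ∈ sqBox ((0 : ℤ), (0 : ℤ)) (n - 1))
    (hU : U ∈ goodLabels k) (hnotB : U ∉ evGlued k p n N M a) (hBx : U ∈ evGlued k p n N M x)
    (hC : U ∈ evCircuit k p n N) (hD : U ∈ evBlocked k p N M) (htest : U ∈ evStepTwo k p n N M a x) :
    affineRelabel p b (pieceS k p n N a U) (pieceLZW k p n N M a x U) U ∈
        goodLabels k ∩ evGlued k p n N M a ∩ evGlued k p n N M x ∩ evCircuit k p n N ∩ evBlocked k p N M ∧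
      circuitOf k p n N (affineRelabel p b (pieceS k p n N a U) (pieceLZW k p n N M a x U) U) = circuitOf k p n N U ∧
      pieceS k p n N a (affineRelabel p b (pieceS k p n N a U) (pieceLZW k p n N M a x U) U) = pieceS k p n N a U ∧
      pieceLZW k p n N M a x U ⊆ pieceS k p n N a U := by
  set U' := affineRelabel p b (pieceS k p n N a U) (pieceLZW k p n N M a x U) U with hU'
  obtain ⟨hη', hC', hD', hΓ', hz', hBa', hBx'⟩ := surgeryZW_spec hp.le hpb hb1.le hU hn hnN hNM hC hD
    (circuitOf_eq (U := U)) ha (landZ_eq (U := U) (a := a)) hnotB hx hBx (landW_eq (U := U) (a := a) (x := x)) (mem_evStepTwo_iff.1 htest) hU'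
  have hcirc : circuitOf k p n N U' = circuitOf k p n N U := hΓ'
  have hzz : landZ k p n N U' a = landZ k p n N U a := by rw [landZ_eq, hcirc, hz', landZ_eq]
  -- geometric facts for `L ⊆ S`
  obtain ⟨hΓo, hs⟩ := isOpenCircuit_circuitOf hC
  have hω := configOfLabels_subset_edgeSet p U
  have haF := mem_insideFin_of_planar_mem_sqBox hΓo hn hnN ha
  have hzadj := exists_planarAdj_zHat hω hΓo hs (U := U) haF
  have hzΓ := zHat_not_mem hω hΓo hs (U := U) haF
  have hxW : x ∈ wDom k (circuitOf k p n N U) (landZ k p n N U a) M :=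
    mem_wDom_of_planar_mem_sqBox hΓo hn (by omega) hzadj hx
  obtain ⟨-, -, -, -, hwadj⟩ := wHat_spec hΓo (by omega) hzadj hxW hBx
  have hwΓ : landW k p n N M U a x ∉ circuitOf k p n N U := fun h =>
    (mem_evStepTwo_iff.1 htest) _ h (SimpleGraph.Reachable.refl _)
  refine ⟨⟨⟨⟨⟨affineRelabel_mem_Icc hp.le (hpb.le.trans hb1.le) (hp.le.trans hpb.le) hb1.le hU _ _, ?_⟩, ?_⟩, hC'⟩, hD'⟩,
    hcirc, ?_, ?_⟩
  · intro g hg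
    rw [hcirc] at hg
    exact hBa' g hg
  · intro g hg
    rw [hcirc] at hg
    exact hBx' g hg
  · rw [pieceS_eq, pieceS_eq, hcirc, hzz]
  · rw [pieceLZW_eq, pieceS_eq]
    exact edgesFin_gammaZW_subset_surgFin hzadj hzΓ hwadj hwΓ

/-- **The surgery of Steps 1, 3 maps `[0,1]^E ∩ (𝓑_a)^c ∩ 𝓑_x ∩ C ∩ D′ ∩ {¬test}` into `𝓑_a ∩ 𝓑_x ∩ C ∩ D′`**, keeps `Γ_min` and
`Ŝ`, stays in `[0,1]^E`. [cite: NewmanTassionWu2017, §4.1 (proof of (g1), the branch "If w ∈ C_{p_c}(z), go to Step 3")] -/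
theorem surgery_mapsTo_Z (hp : 0 < p) (hpb : p < b) (hb1 : b < 1) (hn : 1 ≤ n) (hnN : n ≤ N) (hNM : N + 1 ≤ M)
    (ha : planar k a ∈ sqBox ((0 : ℤ), (0 : ℤ)) (n - 1)) (hx : planar k x ∈ sqBox ((0 : ℤ), (0 : ℤ)) (n - 1))
    (hU : U ∈ goodLabels k) (hnotB : U ∉ evGlued k p n N M a) (hBx : U ∈ evGlued k p n N M x)
    (hC : U ∈ evCircuit k p n N) (hD : U ∈ evBlocked k p N M) (hnotest : U ∉ evStepTwo k p n N M a x) :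
    affineRelabel p b (pieceS k p n N a U) (pieceLZ k p n N a U) U ∈
        goodLabels k ∩ evGlued k p n N M a ∩ evGlued k p n N M x ∩ evCircuit k p n N ∩ evBlocked k p N M ∧
      circuitOf k p n N (affineRelabel p b (pieceS k p n N a U) (pieceLZ k p n N a U) U) = circuitOf k p n N U ∧
      pieceS k p n N a (affineRelabel p b (pieceS k p n N a U) (pieceLZ k p n N a U) U) = pieceS k p n N a U ∧
      pieceLZ k p n N a U ⊆ pieceS k p n N a U := by
  set U' := affineRelabel p b (pieceS k p n N a U) (pieceLZ k p n N a U) U with hU'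
  obtain ⟨hη', hC', hD', hΓ', hz', hBa'⟩ := surgeryZ_spec hp.le hpb hb1.le hU hn hnN hNM hC hD
    (circuitOf_eq (U := U)) ha (landZ_eq (U := U) (a := a)) hnotB hU'
  have hBx' := surgeryZ_Bx hp.le hpb hb1.le hU hn hnN hNM hC hD (circuitOf_eq (U := U)) ha
    (landZ_eq (U := U) (a := a)) hnotB hU' hx hBx (landW_eq (U := U) (a := a) (x := x)) (fun h => hnotest (mem_evStepTwo_iff.2 h))
  have hcirc : circuitOf k p n N U' = circuitOf k p n N U := hΓ'
  have hzz : landZ k p n N U' a = landZ k p n N U a := by rw [landZ_eq, hcirc, hz', landZ_eq]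
  obtain ⟨hΓo, hs⟩ := isOpenCircuit_circuitOf hC
  have hω := configOfLabels_subset_edgeSet p U
  have haF := mem_insideFin_of_planar_mem_sqBox hΓo hn hnN ha
  have hzadj := exists_planarAdj_zHat hω hΓo hs (U := U) haF
  have hzΓ := zHat_not_mem hω hΓo hs (U := U) haF
  refine ⟨⟨⟨⟨⟨affineRelabel_mem_Icc hp.le (hpb.le.trans hb1.le) (hp.le.trans hpb.le) hb1.le hU _ _, ?_⟩, ?_⟩, hC'⟩, hD'⟩,
    hcirc, ?_, ?_⟩
  · intro g hg
    rw [hcirc] at hg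
    exact hBa' g hg
  · intro g hg
    rw [hcirc] at hg
    exact hBx' g hg
  · rw [pieceS_eq, pieceS_eq, hcirc, hzz]
  · rw [pieceLZ_eq, pieceS_eq]
    exact edgesFin_gammaZ_subset_surgFin hzadj hzΓ

/-- **The surgery of Steps 1, 3 maps `[0,1]^E ∩ (𝓑_a)^c ∩ C ∩ D′` into `𝓑_a ∩ C ∩ D′`** (the map used for (g3): "one can skip
Step 2"), keeps `Γ_min` and `Ŝ`, stays in `[0,1]^E`. [cite: NewmanTassionWu2017, §4.1 (proof of (g3): "a map Φ : (𝓑_0)^c ∩ (𝓑_x)^c ∩ 𝒴_A → … can be constructed in essentially the same way … one can skip Step 2")] -/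
theorem surgery_mapsTo_Z3 (hp : 0 < p) (hpb : p < b) (hb1 : b < 1) (hn : 1 ≤ n) (hnN : n ≤ N) (hNM : N + 1 ≤ M)
    (ha : planar k a ∈ sqBox ((0 : ℤ), (0 : ℤ)) (n - 1))
    (hU : U ∈ goodLabels k) (hnotB : U ∉ evGlued k p n N M a)
    (hC : U ∈ evCircuit k p n N) (hD : U ∈ evBlocked k p N M) :
    affineRelabel p b (pieceS k p n N a U) (pieceLZ k p n N a U) U ∈
        goodLabels k ∩ evGlued k p n N M a ∩ evCircuit k p n N ∩ evBlocked k p N M ∧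
      circuitOf k p n N (affineRelabel p b (pieceS k p n N a U) (pieceLZ k p n N a U) U) = circuitOf k p n N U ∧
      pieceS k p n N a (affineRelabel p b (pieceS k p n N a U) (pieceLZ k p n N a U) U) = pieceS k p n N a U ∧
      pieceLZ k p n N a U ⊆ pieceS k p n N a U := by
  set U' := affineRelabel p b (pieceS k p n N a U) (pieceLZ k p n N a U) U with hU'
  obtain ⟨hη', hC', hD', hΓ', hz', hBa'⟩ := surgeryZ_spec hp.le hpb hb1.le hU hn hnN hNM hC hD
    (circuitOf_eq (U := U)) ha (landZ_eq (U := U) (a := a)) hnotB hU'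
  have hcirc : circuitOf k p n N U' = circuitOf k p n N U := hΓ'
  have hzz : landZ k p n N U' a = landZ k p n N U a := by rw [landZ_eq, hcirc, hz', landZ_eq]
  obtain ⟨hΓo, hs⟩ := isOpenCircuit_circuitOf hC
  have hω := configOfLabels_subset_edgeSet p U
  have haF := mem_insideFin_of_planar_mem_sqBox hΓo hn hnN ha
  have hzadj := exists_planarAdj_zHat hω hΓo hs (U := U) haF
  have hzΓ := zHat_not_mem hω hΓo hs (U := U) haF
  refine ⟨⟨⟨⟨affineRelabel_mem_Icc hp.le (hpb.le.trans hb1.le) (hp.le.trans hpb.le) hb1.le hU _ _, ?_⟩, hC'⟩, hD'⟩,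
    hcirc, ?_, ?_⟩
  · intro g hg
    rw [hcirc] at hg
    exact hBa' g hg
  · rw [pieceS_eq, pieceS_eq, hcirc, hzz]
  · rw [pieceLZ_eq, pieceS_eq]
    exact edgesFin_gammaZ_subset_surgFin hzadj hzΓ

end MapsTo

end Summit.CriticalPhenomena.PercolationContinuityZ3.Theorems.Crossing
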